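import Summits.QuantumAdvantage.QuantumAdvantage.Theorems.WalkThreeStepThreeWeightsFar

/-!
# Rung (G♯₂) `ThreeStepFreeRungFive` (item stmt-QuantumAdvantage-23286), architecture (U): NORMALISING the constant cuts
# (first step of the far-read lemma `FarReadHyp`)

Cell qa-qnc0, route OddPrimeWalk, support item stmt-QuantumAdvantage-23286; prover qn-prover-3 g16.

`FarReadHyp` (see `WalkThreeStepAssemblyOfFarRead`) allows RE-REPRESENTING the strategy with the same selection functions.  THIS MODULE:
the canonical re-representation of the CONSTANT cuts — a cut that never fires becomes `[0 = 1]`, a cut that always fires `[0 = 0]`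
(`normalize`; `normalize_y`: same selection functions) — after which every constant cut has `coefS = coefM = 0` and `γ = 0`
(`coefS_normalize_of_const`, …), so it satisfies `NearReads` vacuously; the non-constant cuts are untouched (`normalize_of_not_const`).
Hence the far-read lemma only has to deal with NON-CONSTANT cuts (`nearReads_normalize_iff`-style reduction: `nearReads_normalize_of`).
WHAT THIS IS NOT: not the far-read lemma; separation NOT moved.
-/

namespace Summit.QuantumAdvantage.AdviceFreeQNC0.LocalEngine

open Finset Classical

namespace RungU

variable {p n : ℕ}

/-- cut `g` is CONSTANT: its fire bit does not depend on the input. -/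
def IsConst (S : ThreeStep p n) (g : Fin (n + 1)) : Prop := ∀ u v : Fin n → Bool, S.y g u = S.y g v

/-- re-represent the constant cuts trivially (`[0 = 0]` or `[0 = 1]`), keep the others. -/
noncomputable def normalize [NeZero p] (S : ThreeStep p n) : ThreeStep p n where
  s := fun g => if IsConst S g then 0 else S.s g
  t := fun g => if IsConst S g then 0 else S.t g
  α := fun g => if IsConst S g then 0 else S.α g
  β := fun g => if IsConst S g then 0 else S.β g
  γ := fun g => if IsConst S g then 0 else S.γ g
  r := fun g => if IsConst S g then (if S.y g (fun _ => false) = true then 0 else 1) else S.r g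

/-- a non-constant cut is untouched. -/
theorem normalize_of_not_const [NeZero p] (S : ThreeStep p n) (g : Fin (n + 1)) (h : ¬ IsConst S g) :
    (normalize S).s g = S.s g ∧ (normalize S).t g = S.t g ∧ (normalize S).α g = S.α g ∧ (normalize S).β g = S.β g ∧
      (normalize S).γ g = S.γ g ∧ (normalize S).r g = S.r g := by
  unfold normalize
  simp [if_neg h]

/-- **same selection functions** (needs `p ≥ 2` so that `0 ≠ 1` in `ZMod p`). -/
theorem normalize_y [NeZero p] (hp : 2 ≤ p) (S : ThreeStep p n) : (normalize S).y = S.y := by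
  funext g u
  rw [ThreeStep.y_eq_decide, ThreeStep.y_eq_decide]
  by_cases h : IsConst S g
  · unfold normalize
    simp only [if_pos h, zero_mul, zero_add]
    have hc := h u (fun _ => false)
    rw [ThreeStep.y_eq_decide] at hc
    rw [hc]
    have h01 : (0 : ZMod p) ≠ 1 := by
      haveI : Fact (1 < p) := ⟨by omega⟩
      exact zero_ne_one
    by_cases hf : S.y g (fun _ => false) = true
    · rw [if_pos hf, hf]; simp
    · rw [if_neg hf]
      have hf' : S.y g (fun _ => false) = false := by cases hh : S.y g (fun _ => false) <;> simp_all
      rw [hf']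
      simp [h01]
  · obtain ⟨e1, e2, e3, e4, e5, e6⟩ := normalize_of_not_const S g h
    rw [e1, e2, e3, e4, e5, e6]

/-- a constant cut has zero coefficients after normalisation. -/
theorem coef_normalize_of_const [NeZero p] (S : ThreeStep p n) (g : Fin (n + 1)) (h : IsConst S g) :
    coefS (normalize S) g = 0 ∧ coefM (normalize S) g = 0 ∧ (normalize S).γ g = 0 := by
  unfold coefS coefM normalize
  simp [if_pos h]

/-- **reduction of `NearReads` to the non-constant cuts**: if every NON-constant cut's effective reads into `(a, a+L)` are `R`-near, the
normalised strategy satisfies `NearReads`. -/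
theorem nearReads_normalize_of [NeZero p] (S : ThreeStep p n) (R a L : ℕ)
    (h : ∀ g : Fin (n + 1), ¬ IsConst S g →
      (coefS S g ≠ 0 → a < S.s g → S.s g < a + L → g.val ≤ S.s g + R ∧ S.s g ≤ g.val + R) ∧
      (coefM S g ≠ 0 → a < max (S.s g) (S.t g) → max (S.s g) (S.t g) < a + L →
        g.val ≤ max (S.s g) (S.t g) + R ∧ max (S.s g) (S.t g) ≤ g.val + R)) :
    NearReads (normalize S) R a L := by
  intro g
  by_cases hc : IsConst S g
  · obtain ⟨c1, c2, _⟩ := coef_normalize_of_const S g hc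
    exact ⟨fun hne => absurd c1 hne, fun hne => absurd c2 hne⟩
  · obtain ⟨e1, e2, e3, e4, e5, _⟩ := normalize_of_not_const S g hc
    have cs : coefS (normalize S) g = coefS S g := by unfold coefS; rw [e1, e2, e3, e4, e5]
    have cm : coefM (normalize S) g = coefM S g := by unfold coefM; rw [e1, e2, e4, e5]
    rw [cs, cm, e1, e2]
    exact h g hc

end RungU

end Summit.QuantumAdvantage.AdviceFreeQNC0.LocalEngine
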